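import Mathlib
import Summits.Parity.GeneralizedHardyLittlewood.Theorems.LiouvilleShiftedTablesPairsFromMAvgPerModulus

/-!
# `PairsFromMAvg`, part 7: the main term of the large part

Route `LiouvilleShiftedTables` (Parity / GeneralizedHardyLittlewood), support item stmt-Parity-14275
(`PairsFromMAvg`). With `D₁ = ⌊N/(M₀+1)⌋`, `c₀ = M₀ log M₀ − M₀` and the sums over `d ≤ D₁`, `(d,h) = 1`,
`Σ₁ = ∑ μ(d)/φ(d)`, `Σ₂ = ∑ μ(d) log d/φ(d)`, `Σ₃ = ∑ μ(d) d/φ(d)`: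

  `MT := ∑_{d ≤ D₁, (d,h)=1} μ(d) (d/φ(d)) ∑_{M₀ < m ≤ N/d} log m`
  `    = N (log N − 1) Σ₁ − N Σ₂ − c₀ Σ₃ + O((log N + 1) ∑_{d ≤ D₁} d/φ(d))`

(`abs_mainTerm_sub_le`), from `∑_{m ≤ n} log m = n log n − n + O(log n + 1)` at `n = ⌊N/d⌋` and `n = M₀`
and `⌊N/d⌋ log⌊N/d⌋ − ⌊N/d⌋ = (N/d) log(N/d) − N/d + O(log N + 1)` (part 6).
[cite: BombieriAsymptoticSieve1976, §1; folklore]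
-/

noncomputable section

open Finset Real ArithmeticFunction Filter
open scoped ArithmeticFunction.Moebius

namespace Summit.Parity.GeneralizedHardyLittlewood.Theorems.PairsFromMAvg

/-- For `1 ≤ d ≤ ⌊N/(M₀+1)⌋`: `M₀ + 1 ≤ ⌊N/d⌋`. [folklore] -/
theorem succ_le_div_of_le_div {N M₀ d : ℕ} (hd : 1 ≤ d) (hdD : d ≤ N / (M₀ + 1)) :
    M₀ + 1 ≤ N / d := by
  rw [Nat.le_div_iff_mul_le (by omega)]
  have := (Nat.le_div_iff_mul_le (Nat.succ_pos M₀)).mp hdD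
  rw [mul_comm]; exact this

/-- The per-modulus comparison: for `1 ≤ d ≤ ⌊N/(M₀+1)⌋`,
`|∑_{M₀ < m ≤ N/d} log m − ((N/d)(log N − log d − 1) − (M₀ log M₀ − M₀))| ≤ 3 (log N + 1)`. [folklore] -/
theorem abs_sum_Ioc_log_sub_le {N M₀ d : ℕ} (hd : 1 ≤ d) (hdD : d ≤ N / (M₀ + 1)) :
    |∑ m ∈ Ioc M₀ (N / d), Real.log (m : ℝ) -
        ((N : ℝ) / d * (Real.log N - Real.log d - 1) - ((M₀ : ℝ) * Real.log M₀ - M₀))| ≤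
      3 * (Real.log N + 1) := by
  have hq := succ_le_div_of_le_div hd hdD
  set q : ℕ := N / d with hqdef
  have hMq : M₀ ≤ q := by omega
  have hqN : q ≤ N := Nat.div_le_self N d
  have hMN : M₀ ≤ N := hMq.trans hqN
  have hd0 : (0 : ℝ) < d := by exact_mod_cast hd
  have hN1 : 1 ≤ N := le_trans (by omega : 1 ≤ q) hqN
  have hN0 : (0 : ℝ) < N := by exact_mod_cast hN1
  have hlogN : 0 ≤ Real.log N := Real.log_natCast_nonneg N
  set r : ℝ := (N : ℝ) / d with hr
  have hrq : ⌊r⌋₊ = q := by rw [hr, hqdef]; exact Nat.floor_div_eq_div N d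
  have hr1 : 1 ≤ r := by
    have : (1 : ℝ) ≤ q := by exact_mod_cast (show 1 ≤ q by omega)
    exact this.trans (hrq ▸ Nat.floor_le (by positivity))
  have hrN : r ≤ N := div_le_self hN0.le (by exact_mod_cast hd)
  have hlogr : Real.log r = Real.log N - Real.log d := by rw [hr, Real.log_div hN0.ne' hd0.ne']
  -- the three `O(log N + 1)` comparisons
  have e1 := abs_sum_Icc_log_sub_le q
  have e2 := abs_floor_mul_log_sub_le hr1
  rw [hrq] at e2
  have e3 := abs_sum_Icc_log_sub_le M₀
  have hlq : Real.log q ≤ Real.log N := by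
    rcases Nat.eq_zero_or_pos q with h0 | h0
    · rw [h0]; simp [hlogN]
    · exact Real.log_le_log (by exact_mod_cast h0) (by exact_mod_cast hqN)
  have hlr : Real.log r ≤ Real.log N := Real.log_le_log (by linarith) hrN
  have hlM : Real.log M₀ ≤ Real.log N := by
    rcases Nat.eq_zero_or_pos M₀ with h0 | h0
    · rw [h0]; simp [hlogN]
    · exact Real.log_le_log (by exact_mod_cast h0) (by exact_mod_cast hMN)
  rw [sum_Ioc_log_eq_sub hMq]
  have hY : r * (Real.log N - Real.log d - 1) = r * Real.log r - r := by rw [hlogr]; ring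
  rw [hY]
  have split : ∑ m ∈ Icc 1 q, Real.log (m : ℝ) - ∑ m ∈ Icc 1 M₀, Real.log (m : ℝ) -
      (r * Real.log r - r - ((M₀ : ℝ) * Real.log M₀ - M₀)) =
      (∑ m ∈ Icc 1 q, Real.log (m : ℝ) - ((q : ℝ) * Real.log q - q)) +
      (((q : ℝ) * Real.log q - q) - (r * Real.log r - r)) -
      (∑ m ∈ Icc 1 M₀, Real.log (m : ℝ) - ((M₀ : ℝ) * Real.log M₀ - M₀)) := by ring
  rw [split]
  calc _ ≤ |∑ m ∈ Icc 1 q, Real.log (m : ℝ) - ((q : ℝ) * Real.log q - q)| +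
        |((q : ℝ) * Real.log q - q) - (r * Real.log r - r)| +
        |∑ m ∈ Icc 1 M₀, Real.log (m : ℝ) - ((M₀ : ℝ) * Real.log M₀ - M₀)| := by
          refine (abs_sub _ _).trans (add_le_add (abs_add_le _ _) le_rfl)
    _ ≤ (Real.log q + 1) + (Real.log r + 1) + (Real.log M₀ + 1) := add_le_add (add_le_add e1 e2) e3
    _ ≤ 3 * (Real.log N + 1) := by linarith

/-- **The main term of the large part.** With the sums over `1 ≤ d ≤ D₁ = ⌊N/(M₀+1)⌋`, `(d, h) = 1`:
`|∑ μ(d)(d/φ(d)) ∑_{M₀ < m ≤ N/d} log m − (N(log N − 1)Σ₁ − NΣ₂ − (M₀ log M₀ − M₀)Σ₃)|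
  ≤ 3(log N + 1) ∑_{d ≤ D₁} d/φ(d)`. [cite: BombieriAsymptoticSieve1976, §1] -/
theorem abs_mainTerm_sub_le (h N M₀ : ℕ) :
    |∑ d ∈ (Icc 1 (N / (M₀ + 1))).filter (fun d => d.Coprime h),
        (μ d : ℝ) * ((d : ℝ) / Nat.totient d) * ∑ m ∈ Ioc M₀ (N / d), Real.log (m : ℝ) -
      ((N : ℝ) * (Real.log N - 1) *
          ∑ d ∈ (Icc 1 (N / (M₀ + 1))).filter (fun d => d.Coprime h), (μ d : ℝ) / Nat.totient d -
        (N : ℝ) * ∑ d ∈ (Icc 1 (N / (M₀ + 1))).filter (fun d => d.Coprime h),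
          (μ d : ℝ) * Real.log d / Nat.totient d -
        ((M₀ : ℝ) * Real.log M₀ - M₀) *
          ∑ d ∈ (Icc 1 (N / (M₀ + 1))).filter (fun d => d.Coprime h),
            (μ d : ℝ) * d / Nat.totient d)| ≤
      3 * (Real.log N + 1) * ∑ d ∈ Icc 1 (N / (M₀ + 1)), (d : ℝ) / Nat.totient d := by
  set Fl := (Icc 1 (N / (M₀ + 1))).filter (fun d => d.Coprime h) with hFl
  set c₀ : ℝ := (M₀ : ℝ) * Real.log M₀ - M₀ with hc₀
  set Y : ℕ → ℝ := fun d => (N : ℝ) / d * (Real.log N - Real.log d - 1) - c₀ with hY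
  have hlogN : 0 ≤ Real.log N := Real.log_natCast_nonneg N
  -- the target is `∑ μ w Y`
  have hT : (N : ℝ) * (Real.log N - 1) * ∑ d ∈ Fl, (μ d : ℝ) / Nat.totient d -
      (N : ℝ) * ∑ d ∈ Fl, (μ d : ℝ) * Real.log d / Nat.totient d -
      c₀ * ∑ d ∈ Fl, (μ d : ℝ) * d / Nat.totient d =
      ∑ d ∈ Fl, (μ d : ℝ) * ((d : ℝ) / Nat.totient d) * Y d := by
    rw [Finset.mul_sum, Finset.mul_sum, Finset.mul_sum, ← Finset.sum_sub_distrib,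
      ← Finset.sum_sub_distrib]
    refine Finset.sum_congr rfl fun d hd => ?_
    have hd0 : (d : ℝ) ≠ 0 := by
      have := (Finset.mem_Icc.mp (Finset.mem_filter.mp hd).1).1
      exact_mod_cast (show d ≠ 0 by omega)
    simp only [hY]
    field_simp
    ring
  rw [hT, ← Finset.sum_sub_distrib]
  have key : ∀ d ∈ Fl, |(μ d : ℝ) * ((d : ℝ) / Nat.totient d) * ∑ m ∈ Ioc M₀ (N / d), Real.log (m : ℝ) -
      (μ d : ℝ) * ((d : ℝ) / Nat.totient d) * Y d| ≤ (d : ℝ) / Nat.totient d * (3 * (Real.log N + 1)) := by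
    intro d hd
    obtain ⟨hd', -⟩ := Finset.mem_filter.mp hd
    obtain ⟨hd1, hdD⟩ := Finset.mem_Icc.mp hd'
    rw [← mul_sub, abs_mul, abs_mul, abs_of_nonneg (by positivity : (0 : ℝ) ≤ (d : ℝ) / Nat.totient d)]
    have hμ : |(μ d : ℝ)| ≤ 1 := by exact_mod_cast abs_moebius_le_one
    have hb := abs_sum_Ioc_log_sub_le hd1 hdD
    calc |(μ d : ℝ)| * ((d : ℝ) / Nat.totient d) * |∑ m ∈ Ioc M₀ (N / d), Real.log (m : ℝ) - Y d|
        ≤ 1 * ((d : ℝ) / Nat.totient d) * (3 * (Real.log N + 1)) := by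
          gcongr
      _ = (d : ℝ) / Nat.totient d * (3 * (Real.log N + 1)) := by ring
  calc _ ≤ ∑ d ∈ Fl, |(μ d : ℝ) * ((d : ℝ) / Nat.totient d) * ∑ m ∈ Ioc M₀ (N / d), Real.log (m : ℝ) -
          (μ d : ℝ) * ((d : ℝ) / Nat.totient d) * Y d| := abs_sum_le_sum_abs _ _
    _ ≤ ∑ d ∈ Fl, (d : ℝ) / Nat.totient d * (3 * (Real.log N + 1)) := Finset.sum_le_sum key
    _ ≤ ∑ d ∈ Icc 1 (N / (M₀ + 1)), (d : ℝ) / Nat.totient d * (3 * (Real.log N + 1)) :=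
        Finset.sum_le_sum_of_subset_of_nonneg (Finset.filter_subset _ _) fun d _ _ => by positivity
    _ = 3 * (Real.log N + 1) * ∑ d ∈ Icc 1 (N / (M₀ + 1)), (d : ℝ) / Nat.totient d := by
        rw [← Finset.sum_mul]; ring

end Summit.Parity.GeneralizedHardyLittlewood.Theorems.PairsFromMAvg
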